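import Literature.Topology.FourManifolds.BoundaryGluingRelHomology
import Literature.Topology.FourManifolds.ClosedModelAmbientCollapse
import Literature.Topology.FourManifolds.ClosedModelOrientation
import Literature.Topology.FourManifolds.BCSSignatureAdditivity
import Literature.Topology.FourManifolds.ClosedModelPuncturedCohomology
import Literature.AlgebraicTopology.SingularHomology.LefschetzDualityProofs
import Literature.AlgebraicTopology.SingularHomology.CechCapBridge
import Literature.AlgebraicTopology.SingularHomology.FundamentalClassExistence
import Literature.AlgebraicTopology.SingularHomology.LocalDegreeSign
import Literature.AlgebraicTopology.SingularHomology.UniversalCoefficientsProofs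
import HarnessLib

/-!
# Novikov additivity, the pieces: collapse onto a closed model, induced relative fundamental
# classes, and the support of classes orthogonal to a piece

R. Kirby, *The topology of 4-manifolds*, LNM 1374 (1989), Ch. II §5, Thm. 5.3 (Novikov): for a
closed oriented manifold `P = M ∪_∂ N` glued from two compact oriented manifolds with boundary
along their whole boundaries, `σ(P) = σ(M) + σ(N)`.  This file supplies, for ONE piece `N` of a
boundary gluing `G : BoundaryGluingData` of two null-cobordisms (`jA : M → P`, `jB : N → P`,
`Literature.Topology.FourManifolds.BoundaryGluingRelHomology`), the topological inputs of the
cohomological proof (everything for the other piece follows by `G.symm`):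

* `isOpenEmbedding_jB_interior` — `jB` restricted to the interior `N ∖ ∂N` is an open embedding
  `e : int N → P` with image `P ∖ jA M`.
* `exists_map_jB_eq_ofAbsolute`, `isRelFundamentalClass_of_map_jB_eq` — **the relative
  fundamental class of the piece induced by an orientation of `P`**: for every class
  `α ∈ Hₘ₊₂(P)` there is a unique `w ∈ Hₘ₊₂(N, ∂N)` with `jB_* w = j_* α` in `Hₘ₊₂(P, jA M)`
  (`jB_*` is an isomorphism, `isIso_map_jB_boundary'`), and when `α = [P]` is the fundamental class
  of a `ℤ`-orientation `μ` of `P` this `w` is a relative fundamental class of `(N, ∂N)` in Spanier's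
  sense (local classes transported along the open embedding `e`; Hatcher 2002, p. 253).
* `exists_collapse` — **the collapse `π : P → N̂ = N/∂N`** (Pontryagin–Thom collapse of the
  complement of `e(int N)` to the cone point, the tree's `NullCobordism.exists_ambientCollapse`):
  `π ∘ jB = q_N` (the boundary collapse of `N`), `π(jA M) = ∞`, and **`π_* [P] = [N̂]`**, the
  closed-model class `c_w` of the induced relative fundamental class (Kervaire–Milnor 1963, §7
  footnote pp. 528–529: intersection numbers of `N` are read on the closed homology manifold
  `N ∪ cone ∂N`).

Everything is proved; no definitions, no named facts.

## References

* R. C. Kirby, *The topology of 4-manifolds*, LNM 1374, Springer 1989, Ch. II §5, Thm. 5.3.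
  [Kirby1989]
* A. Hatcher, *Algebraic Topology*, CUP 2002, §3.3 p. 231 (local homology is local), p. 253
  (relative fundamental classes), §2.1 (naturality). [HatcherAT2002]
* M. Kervaire, J. Milnor, *Groups of homotopy spheres I*, Ann. of Math. 77 (1963), §7, footnote
  pp. 528–529. [KervaireMilnorAnnals1963]
-/

noncomputable section

open scoped Manifold ContDiff Topology
open Set Function Filter CategoryTheory Limits Topology
open Literature.AlgebraicTopology.SingularHomology

namespace Literature.Topology.FourManifolds

universe v

namespace BoundaryGluingData

variable {m : ℕ}
variable {S : Type} [TopologicalSpace S] [ChartedSpace (EuclideanSpace ℝ (Fin (m + 1))) S]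
  [IsManifold (𝓡 (m + 1)) ∞ S]
variable {S' : Type} [TopologicalSpace S'] [ChartedSpace (EuclideanSpace ℝ (Fin (m + 1))) S']
  [IsManifold (𝓡 (m + 1)) ∞ S']
variable {cM : NullCobordism (m + 1) S} {cN : NullCobordism (m + 1) S'} {φ : S ≃ S'}
variable {P : Type} [TopologicalSpace P] [ChartedSpace (EuclideanSpace ℝ (Fin (m + 1 + 1))) P]
  [IsManifold (𝓡 (m + 1 + 1)) ∞ P]
variable (G : BoundaryGluingData cM.boundaryData cN.boundaryData φ P)

/-! ### `jB` on the interior is an open embedding onto `P ∖ jA M` -/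

/-- **`jB` restricted to the interior `N ∖ ∂N` is an open embedding `int N → P`** (an
equidimensional smooth embedding is open on interior points,
`isOpen_image_of_isSmoothEmbedding_of_subset_interior`). [folklore] -/
theorem isOpenEmbedding_jB_interior :
    IsOpenEmbedding (fun y : ManifoldInterior (m + 1) cN.W => G.jB y.1) := by
  refine IsOpenEmbedding.of_continuous_injective_isOpenMap
    (G.continuous_jB.comp continuous_subtype_val)
    (fun a b h => Subtype.ext (G.injective_jB h)) fun U hU => ?_
  obtain ⟨V, hV, rfl⟩ := isOpen_induced_iff.1 hU
  have himg : (fun y : ManifoldInterior (m + 1) cN.W => G.jB y.1) '' (Subtype.val ⁻¹' V) =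
      G.jB '' (V ∩ (𝓡∂ (m + 1 + 1)).interior cN.W) := by
    ext p
    constructor
    · rintro ⟨y, hy, rfl⟩
      exact ⟨y.1, ⟨hy, y.2⟩, rfl⟩
    · rintro ⟨b, ⟨hbV, hbi⟩, rfl⟩
      exact ⟨⟨b, hbi⟩, hbV, rfl⟩
  rw [himg]
  exact isOpen_image_of_isSmoothEmbedding_of_subset_interior G.isSmoothEmbedding_jB
    (hV.inter (ModelWithCorners.isOpen_interior (I := 𝓡∂ (m + 1 + 1)) (M := cN.W) (n := ∞)
      (by simp))) inter_subset_right

omit [IsManifold (𝓡 (m + 1 + 1)) ∞ P] in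
/-- The range of `jB` on the interior is `P ∖ jA M`. [folklore] -/
theorem range_jB_interior :
    range (fun y : ManifoldInterior (m + 1) cN.W => G.jB y.1) = (range G.jA)ᶜ := by
  rw [show (range G.jA)ᶜ = G.jB '' (𝓡∂ (m + 1 + 1)).interior cN.W from
    G.symm.image_jA_interior_eq_compl.symm]
  ext p
  constructor
  · rintro ⟨y, rfl⟩
    exact ⟨y.1, y.2, rfl⟩
  · rintro ⟨b, hb, rfl⟩
    exact ⟨⟨b, hb⟩, rfl⟩

omit [IsManifold (𝓡 (m + 1 + 1)) ∞ P] in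
/-- An interior point of `N` is not mapped into the first piece. [folklore] -/
theorem jB_notMem_range_jA {b : cN.W} (hb : b ∈ (𝓡∂ (m + 1 + 1)).interior cN.W) :
    G.jB b ∉ range G.jA := by
  have : G.jB b ∈ range (fun y : ManifoldInterior (m + 1) cN.W => G.jB y.1) := ⟨⟨b, hb⟩, rfl⟩
  rw [G.range_jB_interior] at this
  exact this

omit [IsManifold (𝓡 (m + 1 + 1)) ∞ P] in
/-- The first piece misses `jB b` for `b` interior: `jA M ⊆ P ∖ jB b`. [folklore] -/
theorem range_jA_subset_compl_jB {b : cN.W} (hb : b ∈ (𝓡∂ (m + 1 + 1)).interior cN.W) :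
    range G.jA ⊆ ({G.jB b}ᶜ : Set P) := fun p hp h =>
  G.jB_notMem_range_jA hb (by rw [mem_singleton_iff] at h; rw [← h]; exact hp)

/-! ### Local homology along `jB` at interior points -/

variable (R : Type v) [CommRing R] (Gr : Type v) [AddCommGroup Gr] [Module R Gr]

/-- **`jB` induces isomorphisms of local homology at interior points**:
`(jB)_* : Hₖ(N | b) ≅ Hₖ(P | jB b)` for `b ∈ N ∖ ∂N` (local homology is local, Hatcher 2002,
§3.3 p. 231: both the inclusion of the open interior and `jB` restricted to it are open
embeddings). [cite: HatcherAT2002, §3.3 p. 231] -/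
theorem isIso_map_jB_local [T2Space P] {b : cN.W} (hb : b ∈ (𝓡∂ (m + 1 + 1)).interior cN.W) (k : ℕ) :
    IsIso (relativeSingularHomology.map R Gr (⟨G.jB, G.continuous_jB⟩ : C(cN.W, P))
      (LocalFamily.mapsTo_compl_pt G.injective_jB b) k) := by
  have hι : IsOpenEmbedding (interiorIncl (m + 1) cN.W) :=
    (ModelWithCorners.isOpen_interior (I := 𝓡∂ (m + 1 + 1)) (M := cN.W) (n := ∞)
      (by simp)).isOpenEmbedding_subtypeVal
  let e : C(ManifoldInterior (m + 1) cN.W, P) :=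
    ⟨fun y => G.jB y.1, G.continuous_jB.comp continuous_subtype_val⟩
  have he : IsOpenEmbedding e := G.isOpenEmbedding_jB_interior
  haveI i₁ := localHomology.isIso_map_of_isOpenEmbedding_of_eq R Gr (interiorIncl (m + 1) cN.W) hι
    ⟨b, hb⟩ (rfl : interiorIncl (m + 1) cN.W ⟨b, hb⟩ = b) k
  haveI i₂ := localHomology.isIso_map_of_isOpenEmbedding_of_eq R Gr e he ⟨b, hb⟩
    (rfl : e ⟨b, hb⟩ = G.jB b) k
  have hfac : relativeSingularHomology.map R Gr (interiorIncl (m + 1) cN.W)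
        (Literature.AlgebraicTopology.SingularHomology.mapsTo_compl_singleton_of_injective hι.injective
          (rfl : interiorIncl (m + 1) cN.W ⟨b, hb⟩ = b)) k ≫
      relativeSingularHomology.map R Gr (⟨G.jB, G.continuous_jB⟩ : C(cN.W, P))
        (LocalFamily.mapsTo_compl_pt G.injective_jB b) k =
      relativeSingularHomology.map R Gr e
        (Literature.AlgebraicTopology.SingularHomology.mapsTo_compl_singleton_of_injective he.injective (rfl : e ⟨b, hb⟩ = G.jB b)) k := by
    rw [← relativeSingularHomology.map_comp]
    rfl
  exact IsIso.of_isIso_fac_left hfac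

/-! ### The relative fundamental class of the piece induced by a class of `P` -/

omit [IsManifold (𝓡 (m + 1 + 1)) ∞ P] in
/-- **The local class of the induced relative class at an interior point**: if `jB_* w = j_* α`
then `(jB)_* (w|_b) = α|_{jB b}` for every `b ∈ N ∖ ∂N` (naturality of the exact sequences of the
pairs, Hatcher 2002, §2.1). [cite: HatcherAT2002, §2.1 (naturality)] -/
theorem map_toLocal_eq_toLocal_of_map_jB_eq {k : ℕ} {α : singularHomology R Gr P k}
    {w : relativeSingularHomology R Gr cN.W ((𝓡∂ (m + 1 + 1)).boundary cN.W) k}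
    (hw : relativeSingularHomology.map R Gr (⟨G.jB, G.continuous_jB⟩ : C(cN.W, P))
        G.mapsTo_jB_boundary k w =
      relativeSingularHomology.ofAbsolute R Gr P (range G.jA) k α)
    {b : cN.W} (hb : b ∈ (𝓡∂ (m + 1 + 1)).interior cN.W) :
    relativeSingularHomology.map R Gr (⟨G.jB, G.continuous_jB⟩ : C(cN.W, P))
        (LocalFamily.mapsTo_compl_pt G.injective_jB b) k
        (relativeSingularHomology.toLocal R Gr ((𝓡∂ (m + 1 + 1)).boundary cN.W)
          ⟨b, cN.not_mem_boundary_of_mem_interior hb⟩ k w) =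
      singularHomology.toLocal R Gr (G.jB b) k α := by
  -- both sides are `w` pushed along the map of pairs `(N, ∂N) → (P, P ∖ jB b)`
  have h1 : relativeSingularHomology.toLocal R Gr ((𝓡∂ (m + 1 + 1)).boundary cN.W)
        ⟨b, cN.not_mem_boundary_of_mem_interior hb⟩ k ≫
      relativeSingularHomology.map R Gr (⟨G.jB, G.continuous_jB⟩ : C(cN.W, P))
        (LocalFamily.mapsTo_compl_pt G.injective_jB b) k =
      relativeSingularHomology.map R Gr (⟨G.jB, G.continuous_jB⟩ : C(cN.W, P))
        G.mapsTo_jB_boundary k ≫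
      relativeSingularHomology.map R Gr (ContinuousMap.id P)
        (mapsTo_id_of_subset (G.range_jA_subset_compl_jB hb)) k := by
    rw [relativeSingularHomology.toLocal, ← relativeSingularHomology.map_comp,
      ← relativeSingularHomology.map_comp]
    rfl
  have h2 : relativeSingularHomology.ofAbsolute R Gr P (range G.jA) k ≫
      relativeSingularHomology.map R Gr (ContinuousMap.id P)
        (mapsTo_id_of_subset (G.range_jA_subset_compl_jB hb)) k =
      singularHomology.toLocal R Gr (G.jB b) k := by
    rw [relativeSingularHomology.ofAbsolute_comp_map, singularHomology.map_id, Category.id_comp]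
    rfl
  have := congrArg (fun f => f w) h1
  simp only [ModuleCat.comp_apply] at this
  rw [this, hw, ← ModuleCat.comp_apply, h2]

/-- **The relative fundamental class of a piece induced by an orientation of the glued manifold.**
If `μ` is a `ℤ`-orientation of the compact `P = M ∪_φ N` and `w ∈ Hₘ₊₂(N, ∂N; ℤ)` satisfies
`jB_* w = j_* [P]` in `Hₘ₊₂(P, jA M)`, then `w` is a relative fundamental class of `(N, ∂N)` in
Spanier's sense: its local class at every interior point `b` is carried by the local isomorphism
`(jB)_*` to the local orientation `μ_{jB b}` (Hatcher 2002, §3.3 p. 253: "a relative fundamental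
class restricting to a given orientation at each point of `M − ∂M`", here the orientation of the
interior induced from `P` along the open embedding `jB`). [cite: HatcherAT2002, §3.3 p. 253] -/
theorem isRelFundamentalClass_of_map_jB_eq [CompactSpace P] [T2Space P]
    (μ : HomologicalOrientation ℤ P (m + 1 + 1))
    {w : relativeSingularHomology ℤ ℤ cN.W ((𝓡∂ (m + 1 + 1)).boundary cN.W) (m + 1 + 1)}
    (hw : relativeSingularHomology.map ℤ ℤ (⟨G.jB, G.continuous_jB⟩ : C(cN.W, P))
        G.mapsTo_jB_boundary (m + 1 + 1) w =
      relativeSingularHomology.ofAbsolute ℤ ℤ P (range G.jA) (m + 1 + 1) μ.fundamentalClass) :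
    IsRelFundamentalClass ℤ ((𝓡∂ (m + 1 + 1)).boundary cN.W) w := by
  intro x
  have hb : (x : cN.W) ∈ (𝓡∂ (m + 1 + 1)).interior cN.W := cN.mem_interior_of_mem_compl_boundary x.2
  have hμ' := HomologicalOrientation.isFundamentalClass_fundamentalClass_holds (R := ℤ) (X := P)
    (m + 1 + 1) μ
  have hμ : singularHomology.toLocal ℤ ℤ (G.jB x) (m + 1 + 1) μ.fundamentalClass =
      μ.localClass (G.jB x) := hμ' (G.jB x)
  haveI := G.isIso_map_jB_local ℤ ℤ hb (m + 1 + 1)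
  have key := G.map_toLocal_eq_toLocal_of_map_jB_eq ℤ ℤ hw hb
  rw [hμ] at key
  have key' : relativeSingularHomology.map ℤ ℤ (⟨G.jB, G.continuous_jB⟩ : C(cN.W, P))
      (LocalFamily.mapsTo_compl_pt G.injective_jB (x : cN.W)) (m + 1 + 1)
      (relativeSingularHomology.toLocal ℤ ℤ ((𝓡∂ (m + 1 + 1)).boundary cN.W) x (m + 1 + 1) w) =
      μ.localClass (G.jB x) := key
  rw [← exists_linearEquiv_apply_eq_one_iff_of_isIso
    (relativeSingularHomology.map ℤ ℤ (⟨G.jB, G.continuous_jB⟩ : C(cN.W, P))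
      (LocalFamily.mapsTo_compl_pt G.injective_jB (x : cN.W)) (m + 1 + 1)), key']
  exact μ.isGenerator _

variable [Nonempty S'] [CompactSpace S'] [T2Space S']

/-- **Every class `α ∈ Hₖ(P)` induces a unique relative class `w ∈ Hₖ(N, ∂N)` with
`jB_* w = j_* α`** in `Hₖ(P, jA M)` (`jB_*` is an isomorphism, `isIso_map_jB_boundary'`).
[cite: HatcherAT2002, §2.1 Thm. 2.20 and Prop. 2.22] -/
theorem existsUnique_map_jB_eq_ofAbsolute (k : ℕ) (α : singularHomology R Gr P k) :
    ∃! w : relativeSingularHomology R Gr cN.W ((𝓡∂ (m + 1 + 1)).boundary cN.W) k,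
      relativeSingularHomology.map R Gr (⟨G.jB, G.continuous_jB⟩ : C(cN.W, P))
          G.mapsTo_jB_boundary k w =
        relativeSingularHomology.ofAbsolute R Gr P (range G.jA) k α := by
  haveI := G.isIso_map_jB_boundary' R Gr k
  have hbij : Function.Bijective (relativeSingularHomology.map R Gr
      (⟨G.jB, G.continuous_jB⟩ : C(cN.W, P)) G.mapsTo_jB_boundary k) :=
    ⟨(ModuleCat.mono_iff_injective _).1 inferInstance, (ModuleCat.epi_iff_surjective _).1 inferInstance⟩
  obtain ⟨w, hw⟩ := hbij.2 (relativeSingularHomology.ofAbsolute R Gr P (range G.jA) k α)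
  exact ⟨w, hw, fun w' hw' => hbij.1 (hw'.trans hw.symm)⟩

/-! ### The collapse `π : P → N̂` and `π_* [P] = [N̂]` -/

omit [T2Space S'] in
/-- **The collapse of the glued manifold onto the closed model of a piece, and `π_* [P] = [N̂]`.**
For a boundary gluing `P = M ∪_φ N` (with `P` Hausdorff), a relative class `w ∈ Hₘ₊₂(N, ∂N)` and
a class `α ∈ Hₘ₊₂(P)` with `jB_* w = j_* α` in `Hₘ₊₂(P, jA M)`, there is a continuous
`π : P → N̂ = N ∪ cone(∂N)` with `π (jB b) = q_N b` for all `b ∈ N` (the boundary collapse of `N`),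
`π = ∞` on `jA M`, `π` a map of pairs `(P, P ∖ jB b) → (N̂, N̂ ∖ q_N b)` at interior `b`, and
**`π_* α = c_w`**, the closed-model class of `w` (Kervaire–Milnor 1963, §7 footnote
pp. 528–529; the tree's `NullCobordism.exists_ambientCollapse` applied to the open embedding
`jB|_{int N}`, its local hypothesis being discharged by `map_toLocal_eq_toLocal_of_map_jB_eq` and
`toLocal_closedModelClass_of_mem_interior`).  For `α = [P]` this is `π_* [P] = [N̂]`.
[cite: KervaireMilnorAnnals1963, §7 footnote pp. 528–529] -/
theorem exists_collapse [T2Space P]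
    (w : relativeSingularHomology ℤ ℤ cN.W ((𝓡∂ (m + 1 + 1)).boundary cN.W) (m + 1 + 1))
    (α : singularHomology ℤ ℤ P (m + 1 + 1))
    (hw : relativeSingularHomology.map ℤ ℤ (⟨G.jB, G.continuous_jB⟩ : C(cN.W, P))
        G.mapsTo_jB_boundary (m + 1 + 1) w =
      relativeSingularHomology.ofAbsolute ℤ ℤ P (range G.jA) (m + 1 + 1) α) :
    ∃ π : C(P, ClosedModel (m + 1) cN.W),
      (∀ b : cN.W, π (G.jB b) = boundaryCollapse (m + 1) cN.W b) ∧
      (∀ p ∈ range G.jA, π p = ClosedModel.infty) ∧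
      (∀ (b : cN.W) (hb : b ∈ (𝓡∂ (m + 1 + 1)).interior cN.W),
        MapsTo π ({G.jB b}ᶜ : Set P) ({ClosedModel.ofInterior ⟨b, hb⟩}ᶜ : Set _)) ∧
      singularHomology.map ℤ ℤ π (m + 1 + 1) α =
        cN.closedModelClass ℤ ℤ (Nat.le_add_left 1 m) w := by
  have hn : 1 ≤ m + 1 := Nat.le_add_left 1 m
  let e : C(ManifoldInterior (m + 1) cN.W, P) :=
    ⟨fun y => G.jB y.1, G.continuous_jB.comp continuous_subtype_val⟩
  have he : IsOpenEmbedding e := G.isOpenEmbedding_jB_interior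
  obtain ⟨π, hπe, hπout, hmaps, hclass⟩ := cN.exists_ambientCollapse e he
  have hrange : range e = (range G.jA)ᶜ := G.range_jB_interior
  refine ⟨π, fun b => ?_, fun p hp => hπout p (by rw [hrange]; exact fun h => h hp),
    fun b hb => hmaps ⟨b, hb⟩, hclass α w fun y => ?_⟩
  · by_cases hb : b ∈ (𝓡∂ (m + 1 + 1)).interior cN.W
    · rw [boundaryCollapse_of_mem_interior hb]
      exact hπe ⟨b, hb⟩
    · rw [boundaryCollapse_apply, boundaryCollapseFun_of_not_mem hb]
      refine hπout _ ?_
      rw [hrange, mem_compl_iff, not_not]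
      have hb' : b ∈ (𝓡∂ (m + 1 + 1)).boundary cN.W := by
        rw [← ModelWithCorners.compl_interior]; exact hb
      exact G.mapsTo_jB_boundary hb'
  · -- the local hypothesis of the class transfer, at the interior point `y`
    have hyint : (y.1 : cN.W) ∈ (𝓡∂ (m + 1 + 1)).interior cN.W := y.2
    have hι : IsOpenEmbedding (interiorIncl (m + 1) cN.W) :=
      (ModelWithCorners.isOpen_interior (I := 𝓡∂ (m + 1 + 1)) (M := cN.W) (n := ∞)
        (by simp)).isOpenEmbedding_subtypeVal
    haveI hiso := localHomology.isIso_map_of_isOpenEmbedding_of_eq ℤ ℤ (interiorIncl (m + 1) cN.W)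
      hι y (rfl : interiorIncl (m + 1) cN.W y = y.1) (m + 1 + 1)
    -- the common class on `int N`: the local class of `w` pulled back to the interior
    set ℓ := relativeSingularHomology.toLocal ℤ ℤ ((𝓡∂ (m + 1 + 1)).boundary cN.W)
      ⟨y.1, cN.not_mem_boundary_of_mem_interior hyint⟩ (m + 1 + 1) w with hℓ
    set ζ := inv (relativeSingularHomology.map ℤ ℤ (interiorIncl (m + 1) cN.W)
      (Literature.AlgebraicTopology.SingularHomology.mapsTo_compl_singleton_of_injective hι.injective
        (rfl : interiorIncl (m + 1) cN.W y = y.1)) (m + 1 + 1)) ℓ with hζ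
    have hζ' : relativeSingularHomology.map ℤ ℤ (interiorIncl (m + 1) cN.W)
        (Literature.AlgebraicTopology.SingularHomology.mapsTo_compl_singleton_of_injective hι.injective
          (rfl : interiorIncl (m + 1) cN.W y = y.1)) (m + 1 + 1) ζ = ℓ := by
      rw [hζ, ← ModuleCat.comp_apply, IsIso.inv_hom_id, ModuleCat.id_apply]
    refine ⟨ζ, ?_, ?_⟩
    · -- at `e y = jB y`: `α|_{jB y} = jB_* (w|_y) = (jB ∘ ι)_* ζ = e_* ζ`
      have s1 := G.map_toLocal_eq_toLocal_of_map_jB_eq ℤ ℤ hw hyint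
      rw [← hℓ] at s1
      change singularHomology.toLocal ℤ ℤ (G.jB y.1) (m + 1 + 1) α = _
      rw [← s1, ← hζ', ← ModuleCat.comp_apply, ← relativeSingularHomology.map_comp]
      rfl
    · -- at `y`: `c_w|_{q y} = q_* (w|_y) = (q ∘ ι)_* ζ = coe_* ζ`
      have e2 : boundaryCollapse (m + 1) cN.W y.1 = ClosedModel.ofInterior y := by
        rw [boundaryCollapse_of_mem_interior hyint]
        rfl
      have s1 := cN.toLocal_closedModelClass_of_mem_interior ℤ ℤ hn w hyint
      rw [← hℓ, ← hζ', ← ModuleCat.comp_apply, ← relativeSingularHomology.map_comp] at s1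
      let f : C(ManifoldInterior (m + 1) cN.W, ClosedModel (m + 1) cN.W) :=
        (boundaryCollapse (m + 1) cN.W).comp (interiorIncl (m + 1) cN.W)
      have hfp : MapsTo f ({y}ᶜ : Set _) ({boundaryCollapse (m + 1) cN.W y.1}ᶜ : Set _) :=
        (cN.mapsTo_boundaryCollapse_compl_singleton hyint).comp
          (Literature.AlgebraicTopology.SingularHomology.mapsTo_compl_singleton_of_injective hι.injective
            (rfl : interiorIncl (m + 1) cN.W y = y.1))
      have hfq : MapsTo f ({y}ᶜ : Set _) ({ClosedModel.ofInterior y}ᶜ : Set _) := by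
        rw [← e2]; exact hfp
      have s2 : singularHomology.toLocal ℤ ℤ (boundaryCollapse (m + 1) cN.W y.1) (m + 1 + 1)
          (cN.closedModelClass ℤ ℤ hn w) = relativeSingularHomology.map ℤ ℤ f hfp (m + 1 + 1) ζ :=
        s1
      have s3 := (singularHomology.toLocal_eq_map_iff_of_eq e2 (m + 1 + 1) _ f hfp hfq ζ).1 s2
      have hfg : f = NullCobordism.ofInteriorCM cN := boundaryCollapse_comp_interiorIncl
      exact s3.trans (ConcreteCategory.congr_hom
        (relativeSingularHomology.map_congr ℤ ℤ hfg hfq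
          (LocalFamily.mapsTo_compl_pt (NullCobordism.isOpenEmbedding_ofInteriorCM cN).injective y)
          (m + 1 + 1)) ζ)

/-! ### The thickening `A_ε = jA M ∪ jB(C_ε)` deformation retracts onto the first piece -/

omit [CompactSpace S'] [T2Space S'] in
/-- **A deformation of the thickening onto the first piece** (existence form of the gluing slide of
`BoundaryGluingRelHomology.lean`): for `ε > 0` there is a homotopy `H : [0,1] × A_ε → A_ε` with
`H₀ = id`, `H₁(A_ε) ⊆ jA M` and `H_t = id` on `jA M` — on `jB(C_ε)` slide down the collar lines of
`N` and fix everything else; the prescriptions agree on the seam, and paste along the closed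
cover of `[0,1] × A_ε` by the traces of the two pieces (Hatcher 2002, proof of Prop. 2.22).
[cite: HatcherAT2002, §2.1, Prop. 2.22 (proof)] -/
theorem exists_deformation_thickening (κ : cN.boundaryData.Collar) {ε : ℝ} (hε : 0 < ε) :
    ∃ H : C(unitInterval × ↥(range G.jA ∪ G.jB '' cN.collarNhd κ ε),
        ↥(range G.jA ∪ G.jB '' cN.collarNhd κ ε)),
      (∀ x, H (0, x) = x) ∧ (∀ x, (H (1, x) : P) ∈ range G.jA) ∧
      ∀ (s : unitInterval) (x : ↥(range G.jA ∪ G.jB '' cN.collarNhd κ ε)),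
        (x : P) ∈ range G.jA → H (s, x) = x := by
  classical
  haveI : Nonempty cN.W := ⟨cN.incl (Classical.arbitrary S')⟩
  set A : Set P := range G.jA ∪ G.jB '' cN.collarNhd κ ε with hA
  set f : unitInterval × P → P := fun q =>
    if q.2 ∈ G.jB '' cN.collarNhd κ ε then
      G.jB (κ ((cN.collarInv κ (G.invB q.2)).1,
        NullCobordism.slide q.1 (cN.collarInv κ (G.invB q.2)).2))
    else q.2 with hf
  have hf_jB : ∀ (s : unitInterval) {b : cN.W} (hb : b ∈ cN.collarNhd κ ε),
      f (s, G.jB b) = G.jB (cN.collarSlide κ ε (s, ⟨b, hb⟩)) := fun s b hb => by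
    simp only [hf, if_pos (show G.jB b ∈ G.jB '' cN.collarNhd κ ε from ⟨b, hb, rfl⟩),
      NullCobordism.collarSlide_apply_coe, G.invB_jB]
  have hf_out : ∀ (s : unitInterval) {p : P}, p ∉ G.jB '' cN.collarNhd κ ε → f (s, p) = p :=
    fun s p hp => by simp only [hf, if_neg hp]
  have hf_fix : ∀ (s : unitInterval) {p : P}, p ∈ range G.jA → f (s, p) = p := by
    intro s p hp
    by_cases h : p ∈ G.jB '' cN.collarNhd κ ε
    · obtain ⟨b, hb, rfl⟩ := h
      have hbd : b ∈ (𝓡∂ (m + 1 + 1)).boundary cN.W := by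
        rw [← G.preimage_jB_range_jA]; exact hp
      rw [hf_jB s hb, cN.collarSlide_of_mem_boundary κ ε s ⟨b, hb⟩ hbd]
    · exact hf_out s h
  have hf_zero : ∀ p : P, f (0, p) = p := by
    intro p
    by_cases h : p ∈ G.jB '' cN.collarNhd κ ε
    · obtain ⟨b, hb, rfl⟩ := h
      rw [hf_jB 0 hb, cN.collarSlide_zero]
    · exact hf_out 0 h
  have hf_one : ∀ {p : P}, p ∈ A → f (1, p) ∈ range G.jA := by
    intro p hp
    by_cases h : p ∈ G.jB '' cN.collarNhd κ ε
    · obtain ⟨b, hb, rfl⟩ := h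
      rw [hf_jB 1 hb]
      exact G.mapsTo_jB_boundary (cN.collarSlide_one_mem κ ε ⟨b, hb⟩)
    · rw [hf_out 1 h]
      exact hp.resolve_right h
  have hf_mem : ∀ (s : unitInterval) {p : P}, p ∈ A → f (s, p) ∈ A := by
    intro s p hp
    by_cases h : p ∈ G.jB '' cN.collarNhd κ ε
    · obtain ⟨b, hb, rfl⟩ := h
      rw [hf_jB s hb]
      exact Or.inr ⟨_, (cN.collarSlide κ ε (s, ⟨b, hb⟩)).2, rfl⟩
    · rw [hf_out s h]
      exact hp
  have hcont : Continuous fun q : unitInterval × ↥A => f (q.1, q.2.1) := by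
    rw [← continuousOn_univ]
    set T : Set (unitInterval × ↥A) := {q | (q.2 : P) ∈ range G.jA} with hT
    set T' : Set (unitInterval × ↥A) := {q | (q.2 : P) ∈ range G.jB} with hT'
    have hval : Continuous fun q : unitInterval × ↥A => (q.2 : P) :=
      continuous_subtype_val.comp continuous_snd
    have hTc : IsClosed T := G.isClosed_range_jA.preimage hval
    have hT'c : IsClosed T' := G.isClosed_range_jB.preimage hval
    have hcov : T ∪ T' = univ := eq_univ_of_forall fun q =>
      (G.range_union.symm.subset (mem_univ (q.2 : P))).imp id id
    have hmemT' : ∀ q ∈ T', (q.2 : P) ∈ G.jB '' cN.collarNhd κ ε := fun q hq => by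
      rw [← G.thickening_inter_range_jB κ hε]; exact ⟨q.2.2, hq⟩
    rw [← hcov]
    refine ContinuousOn.union_of_isClosed ?_ ?_ hTc hT'c
    · exact hval.continuousOn.congr fun q hq => hf_fix q.1 hq
    · have hinvB : ContinuousOn (fun q : unitInterval × ↥A => G.invB (q.2 : P)) T' :=
        G.continuousOn_invB.comp hval.continuousOn fun q hq => hq
      have hrange : ∀ q ∈ T', G.invB (q.2 : P) ∈ range κ := fun q hq => by
        obtain ⟨b, hb, hbq⟩ := hmemT' q hq
        rw [← hbq, G.invB_jB]
        exact cN.collarNhd_subset_range κ ε hb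
      have hcinv : ContinuousOn
          (fun q : unitInterval × ↥A => cN.collarInv κ (G.invB (q.2 : P))) T' :=
        (cN.continuousOn_collarInv κ).comp hinvB hrange
      have hg : ContinuousOn (fun q : unitInterval × ↥A =>
          G.jB (κ ((cN.collarInv κ (G.invB (q.2 : P))).1,
            NullCobordism.slide q.1 (cN.collarInv κ (G.invB (q.2 : P))).2))) T' := by
        refine G.continuous_jB.comp_continuousOn (κ.continuous.comp_continuousOn ?_)
        refine (continuous_fst.comp_continuousOn hcinv).prodMk ?_
        exact NullCobordism.continuous_slide.comp_continuousOn
          (continuous_fst.continuousOn.prodMk (continuous_snd.comp_continuousOn hcinv))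
      refine hg.congr fun q hq => ?_
      show f (q.1, (q.2 : P)) = _
      simp only [hf, if_pos (hmemT' q hq)]
  exact ⟨⟨fun q => ⟨f (q.1, q.2.1), hf_mem q.1 q.2.2⟩, hcont.subtype_mk _⟩,
    fun x => Subtype.ext (hf_zero x.1), fun x => hf_one x.2,
    fun s x hx => Subtype.ext (hf_fix s hx)⟩

omit [CompactSpace S'] [T2Space S'] in
/-- **A class killed by the first piece vanishes on its thickening**: if `jA^* u = 0` in
`Hᵏ(M; ℤ)` then `u` restricts to `0` on the open set `A_ε = jA M ∪ jB(C_ε)` (`ε > 0`), which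
deformation retracts onto `jA M` (`exists_deformation_thickening`; homotopy invariance of
cohomology, `singularCohomology.map_eq_of_homotopic'`). This is "`x` can be pushed off `N`" in
Kirby 1989, proof of Thm. 5.3, read cohomologically. [cite: Kirby1989, Ch. II §5, Thm. 5.3 (proof)] -/
theorem cohomologyMap_subsetIncl_thickening_eq_zero (κ : cN.boundaryData.Collar) {ε : ℝ}
    (hε : 0 < ε) {k : ℕ} (u : singularCohomology ℤ ℤ P k)
    (hu : singularCohomology.map ℤ ℤ (⟨G.jA, G.continuous_jA⟩ : C(cM.W, P)) k u = 0) :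
    singularCohomology.map ℤ ℤ (subsetIncl (range G.jA ∪ G.jB '' cN.collarNhd κ ε)) k u = 0 := by
  haveI : Nonempty cM.W := by
    obtain ⟨s'⟩ := (inferInstance : Nonempty S')
    exact ⟨cM.incl (φ.symm s')⟩
  set A : Set P := range G.jA ∪ G.jB '' cN.collarNhd κ ε with hA
  obtain ⟨H, h0, h1, -⟩ := G.exists_deformation_thickening κ hε
  -- the end `r₁ = H₁` of the deformation factors through `jA`
  have hH1 : Continuous fun x : ↥A => H (1, x) :=
    H.continuous.comp (continuous_const.prodMk continuous_id)
  let ρ : C(↥A, cM.W) := ⟨fun x => G.invA (H (1, x) : P),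
    G.continuousOn_invA.comp_continuous (continuous_subtype_val.comp hH1) fun x => h1 x⟩
  have hfac : (subsetIncl A).comp ⟨fun x => H (1, x), hH1⟩ =
      (⟨G.jA, G.continuous_jA⟩ : C(cM.W, P)).comp ρ := by
    ext x
    exact (G.jA_invA (h1 x)).symm
  -- `subsetIncl A ≃ subsetIncl A ∘ H₁`
  have hhom : (subsetIncl A).Homotopic ((subsetIncl A).comp ⟨fun x => H (1, x), hH1⟩) :=
    ⟨{ toFun := fun q => (H q : P)
       continuous_toFun := continuous_subtype_val.comp H.continuous
       map_zero_left := fun x => by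
         show (H (0, x) : P) = x
         rw [h0 x]
       map_one_left := fun x => rfl }⟩
  rw [singularCohomology.map_eq_of_homotopic' ℤ ℤ hhom k, hfac, singularCohomology.map_comp,
    ModuleCat.comp_apply, hu, map_zero]

/-! ### Classes pulled back from the closed model of `N` vanish on the thickening of `M` -/

omit [IsManifold (𝓡 (m + 1 + 1)) ∞ P] [T2Space S'] in
/-- **`π^* a` vanishes on `A₁ = jA M ∪ jB(C₁)`** for the collapse `π : P → N̂` (`π ∘ jB = q_N`,
`π(jA M) = ∞`) and `a ∈ Hᵏ(N̂; ℤ)`, `k ≠ 0`: `π` maps `A₁` into the cone neighbourhood `N₁` of the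
cone point, which is contractible (`NullCobordism.isZero_singularCohomology_coneNhd`).
[cite: KervaireMilnorAnnals1963, §7 footnote pp. 528–529] -/
theorem cohomologyMap_subsetIncl_collapse_eq_zero (κ : cN.boundaryData.Collar)
    (π : C(P, ClosedModel (m + 1) cN.W))
    (hπjB : ∀ b : cN.W, π (G.jB b) = boundaryCollapse (m + 1) cN.W b)
    (hπA : ∀ p ∈ range G.jA, π p = ClosedModel.infty) {k : ℕ} (hk : k ≠ 0)
    (a : singularCohomology ℤ ℤ (ClosedModel (m + 1) cN.W) k) :
    singularCohomology.map ℤ ℤ (subsetIncl (range G.jA ∪ G.jB '' cN.collarNhd κ 1)) k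
      (singularCohomology.map ℤ ℤ π k a) = 0 := by
  have hmaps : MapsTo π (range G.jA ∪ G.jB '' cN.collarNhd κ 1) (cN.coneNhd κ 1) := by
    rintro p (hp | ⟨b, hb, rfl⟩)
    · rw [hπA p hp]
      exact cN.infty_mem_coneNhd κ 1
    · rw [hπjB b]
      exact cN.mapsTo_boundaryCollapse_collarNhd κ 1 hb
  have hfac : π.comp (subsetIncl (range G.jA ∪ G.jB '' cN.collarNhd κ 1)) =
      (subsetIncl (cN.coneNhd κ 1)).comp ⟨hmaps.restrict π _ _,
        (π.continuous.comp continuous_subtype_val).subtype_mk _⟩ := rfl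
  rw [← ModuleCat.comp_apply, ← singularCohomology.map_comp, hfac, singularCohomology.map_comp,
    (cN.isZero_singularCohomology_coneNhd κ hk).eq_of_tgt
      (singularCohomology.map ℤ ℤ (subsetIncl (cN.coneNhd κ 1)) k) 0, zero_comp]
  rfl

end BoundaryGluingData

end Literature.Topology.FourManifolds

end
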